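import Mathlib
import Summits.NavierStokesRegularity.NavierStokesRegularity.Theorems.TaoLadderRungTwoBreakBlowupRigidityOneMixedDrainPairTransmission
import Summits.NavierStokesRegularity.NavierStokesRegularity.Theorems.TaoLadderRungTwoBreakBlowupRigidityOneViscousEnergyBound
import HarnessLib

/-!
# Two tools for tail estimates along `ν̂`-viscous cascade flows (general table, `ν̂ ≥ 0` incl. the exact flow): the
  PARTIAL-ENERGY BALANCE `(Σ_{k≤K} ‖x_k‖²)' = −f_K − (dissipation)` and the GEOMETRIC DECAY OF THE TOP FLUX
  `|f_K| ≤ C_f q^K` on `[0,t]` (`q = Λ(1+ε₀)^{−10} < 1`) from (4.5)-regularity — the `K → ∞` device behind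
  `viscousPartialEnergy_le_datumEnergy`, exported — plus a square-root comparison lemma WITH ADDITIVE ERROR; used by the
  viscous transmission law of the mixed-drain pair (census item (MP′) of K2(1) `TaoLadderRungTwoBreak.BlowupRigidityOne`,
  stmt-NavierStokesRegularity-20206; `--supports`)

MODEL lattice ODEs only (Tao 2016 §4: the NS-scaled viscous lattice before Thm. 4.2, (4.3), Lemma 4.1 (4.5), (4.9));
nothing here is a statement about the Navier–Stokes equations; NO item is closed.  DEF-FREE; ROUTE-INDEPENDENT; general `m`.

* `sqrt_le_of_deriv_le_sqrt_add` — `Ψ ≥ 0`, `Ψ(0) = 0`, `Ψ' ≤ w√Ψ + η` (`η ≥ 0`), `J' = w ≥ 0` on `[0,t]` ⇒ for every `δ > 0`,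
  `√Ψ(t) ≤ δ + (J(t) − J(0))/2 + ηt/(2δ)` (monotonicity of `J/2 + ηs/(2δ) − √(Ψ + δ²)`);
* `viscousPartialEnergy_hasDerivWithinAt` — `d/dt Σ_{k≤K} ‖x_k‖² = −f_K − Σ_{k≤K} 2ν̂(1+ε₀)^{2k}‖x_k‖²`,
  `f_K = 2Λ^K ⟪x_{K+1}, A x_K⟫` (telescoped shell balances, no shells below `0`);
* `viscousTopFlux_le_geometric` — on `[0,t]`, `t < T`: `|f_K| ≤ C_f q^K` for all `K`, with `C_f ≥ 0`, `0 ≤ q < 1`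
  (`C_f = 2 C_A (√m M)³`, `M` the (4.5) constant on `[0,t]`).

HONEST LABEL: calculus bookkeeping for the lattice; no stub, crux, rung or summit is proved; rung 0.
-/

noncomputable section

-- the summit and its single sub-problem share the name (CONVENTIONS §1)
set_option linter.dupNamespace false

open Set Filter Topology MeasureTheory
open scoped RealInnerProductSpace

namespace Summit.NavierStokesRegularity.NavierStokesRegularity.Theorems

namespace BlowupRigidityOne

open Literature.Analysis.FluidPDE Literature.Analysis.FluidPDE.TaoCascade

variable {m : ℕ}

/-- **Square-root comparison with additive error.**  If `Ψ ≥ 0` on `[0,T)` with `Ψ(0) = 0` and one-sided derivative `Ψ'`,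
`J` has one-sided derivative `w ≥ 0`, `η ≥ 0`, and `Ψ' ≤ w√Ψ + η` on `[0,t]`, then for every `δ > 0`,
`√Ψ(t) ≤ δ + (J(t) − J(0))/2 + η t/(2δ)` (monotonicity of `J/2 + ηs/(2δ) − √(Ψ + δ²)`). [folklore] -/
theorem sqrt_le_of_deriv_le_sqrt_add {Ψ Ψ' w J : ℝ → ℝ} {T t η : ℝ} (ht : t ∈ Ico 0 T)
    (hΨ : ∀ τ ∈ Ico 0 T, HasDerivWithinAt Ψ (Ψ' τ) (Ici 0) τ) (hΨnn : ∀ τ ∈ Ico 0 T, 0 ≤ Ψ τ) (hΨ0 : Ψ 0 = 0)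
    (hJ : ∀ τ ∈ Ico 0 T, HasDerivWithinAt J (w τ) (Ici 0) τ) (hη : 0 ≤ η)
    (hle : ∀ τ ∈ Icc 0 t, Ψ' τ ≤ w τ * Real.sqrt (Ψ τ) + η) (hw : ∀ τ ∈ Icc 0 t, 0 ≤ w τ) {δ : ℝ} (hδ : 0 < δ) :
    Real.sqrt (Ψ t) ≤ δ + (J t - J 0) / 2 + η * t / (2 * δ) := by
  have hφ : ∀ τ ∈ Ico (0 : ℝ) T, HasDerivWithinAt (fun s => J s / 2 + η * s / (2 * δ) - Real.sqrt (Ψ s + δ ^ 2))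
      (w τ / 2 + η / (2 * δ) - Ψ' τ / (2 * Real.sqrt (Ψ τ + δ ^ 2))) (Ici 0) τ := by
    intro τ hτ
    have hpos : Ψ τ + δ ^ 2 ≠ 0 := by have := hΨnn τ hτ; positivity
    have hlin : HasDerivWithinAt (fun s => η * s / (2 * δ)) (η / (2 * δ)) (Ici 0) τ := by
      have h := ((hasDerivAt_id τ).const_mul η).div_const (2 * δ)
      rw [mul_one] at h
      exact h.hasDerivWithinAt
    exact (((hJ τ hτ).div_const 2).add hlin).sub (((hΨ τ hτ).add_const (δ ^ 2)).sqrt hpos)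
  have hφ' : ∀ τ ∈ Icc (0 : ℝ) t, 0 ≤ w τ / 2 + η / (2 * δ) - Ψ' τ / (2 * Real.sqrt (Ψ τ + δ ^ 2)) := by
    intro τ hτ
    have hτT : τ ∈ Ico (0 : ℝ) T := ⟨hτ.1, lt_of_le_of_lt hτ.2 ht.2⟩
    have hΨτ := hΨnn τ hτT
    have hs : 0 < Real.sqrt (Ψ τ + δ ^ 2) := Real.sqrt_pos.2 (by positivity)
    have hδs : δ ≤ Real.sqrt (Ψ τ + δ ^ 2) := by
      rw [← Real.sqrt_sq hδ.le]
      exact Real.sqrt_le_sqrt (by rw [Real.sqrt_sq hδ.le]; linarith)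
    have h1 : Real.sqrt (Ψ τ) ≤ Real.sqrt (Ψ τ + δ ^ 2) := Real.sqrt_le_sqrt (by nlinarith)
    have h2 : Ψ' τ ≤ w τ * Real.sqrt (Ψ τ + δ ^ 2) + η / δ * Real.sqrt (Ψ τ + δ ^ 2) := by
      have h3 : η ≤ η / δ * Real.sqrt (Ψ τ + δ ^ 2) :=
        calc η = η / δ * δ := by field_simp
          _ ≤ η / δ * Real.sqrt (Ψ τ + δ ^ 2) := mul_le_mul_of_nonneg_left hδs (div_nonneg hη hδ.le)
      have h4 : w τ * Real.sqrt (Ψ τ) ≤ w τ * Real.sqrt (Ψ τ + δ ^ 2) := mul_le_mul_of_nonneg_left h1 (hw τ hτ)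
      linarith [hle τ hτ]
    rw [sub_nonneg, div_le_iff₀ (by positivity)]
    calc Ψ' τ ≤ w τ * Real.sqrt (Ψ τ + δ ^ 2) + η / δ * Real.sqrt (Ψ τ + δ ^ 2) := h2
      _ = (w τ / 2 + η / (2 * δ)) * (2 * Real.sqrt (Ψ τ + δ ^ 2)) := by field_simp
  have h := le_of_hasDerivWithinAt_Ici_nonneg ht hφ hφ' t ⟨ht.1, le_rfl⟩
  simp only [hΨ0, zero_add, mul_zero, zero_div, add_zero] at h
  rw [Real.sqrt_sq hδ.le] at h
  have h3 : Real.sqrt (Ψ t) ≤ Real.sqrt (Ψ t + δ ^ 2) := Real.sqrt_le_sqrt (by nlinarith [hΨnn t ht])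
  linarith

/-- **Partial-energy balance along a `ν̂`-viscous flow** (any `ν̂`, cancelling table, no shells below `0`): on `[0,T)`,
`d/dt Σ_{k≤K} ‖x_k‖² = −f_K − Σ_{k≤K} 2ν̂(1+ε₀)^{2k} ‖x_k‖²` with `f_K = 2Λ^K⟪x_{K+1}, A x_K⟫` (one-sided, within `[0,∞)`).
[cite: Tao2016AveragedNS, §4 (4.3), Lemma 4.1 (4.9) and the viscous equation before Thm. 4.2] -/
theorem viscousPartialEnergy_hasDerivWithinAt {ε₀ ν T : ℝ} (hε : 0 < ε₀)
    {α : Fin m → Fin m → Fin m → ℤ × ℤ × ℤ → ℝ} (hc : IsCancellingCoeff α) {X : Fin m → ℤ → ℝ → ℝ}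
    (hder : ∀ i k, ∀ t ∈ Ico 0 T, HasDerivWithinAt (X i k)
      (quadTerm ε₀ α X i k t - ν * (1 + ε₀) ^ ((2 : ℝ) * k) * X i k t) (Ici 0) t)
    (hlow : ∀ i k t, k < 0 → X i k t = 0) (K : ℕ) {τ : ℝ} (hτ : τ ∈ Ico 0 T) :
    HasDerivWithinAt (fun s => ∑ k ∈ Finset.range (K + 1), ‖shellVec X (k : ℤ) s‖ ^ 2)
      (-(2 * bigLam ε₀ ^ (K : ℤ) * ⟪shellVec X ((K : ℤ) + 1) τ, tableA α (shellVec X (K : ℤ) τ)⟫) -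
        ∑ k ∈ Finset.range (K + 1),
          2 * (ν * (1 + ε₀) ^ ((2 : ℝ) * ((k : ℤ) : ℝ))) * ‖shellVec X (k : ℤ) τ‖ ^ 2) (Ici 0) τ := by
  set f : ℤ → ℝ → ℝ := fun k s =>
    2 * bigLam ε₀ ^ k * ⟪shellVec X (k + 1) s, tableA α (shellVec X k s)⟫ with hfdef
  set d : ℕ → ℝ → ℝ := fun k s =>
    2 * (ν * (1 + ε₀) ^ ((2 : ℝ) * ((k : ℤ) : ℝ))) * ‖shellVec X (k : ℤ) s‖ ^ 2 with hddef
  have hxneg : shellVec X (-1) τ = 0 := by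
    ext i; simp [shellVec, hlow i (-1) τ (by norm_num)]
  have hfneg : f (-1) τ = 0 := by
    simp only [hfdef]
    rw [hxneg, tableA_zero hc, inner_zero_right, mul_zero]
  have hterm : ∀ k ∈ Finset.range (K + 1), HasDerivWithinAt (fun s => ‖shellVec X (k : ℤ) s‖ ^ 2)
      ((f ((k : ℤ) - 1) τ - f k τ) - d k τ) (Ici 0) τ := by
    intro k _
    have h := viscousShellEnergy_hasDerivWithinAt hε hc (ν := ν) (k := (k : ℤ)) (fun i => hder i k τ hτ)
    simp only [hfdef, hddef, sub_add_cancel]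
    exact h
  have hsum := HasDerivWithinAt.sum hterm
  have htel : ∑ k ∈ Finset.range (K + 1), ((f ((k : ℤ) - 1) τ - f k τ) - d k τ) =
      -(f K τ) - ∑ k ∈ Finset.range (K + 1), d k τ := by
    rw [Finset.sum_sub_distrib]
    have h := Finset.sum_range_sub' (fun k : ℕ => f ((k : ℤ) - 1) τ) (K + 1)
    have e : ∀ k : ℕ, f (((k + 1 : ℕ) : ℤ) - 1) τ = f (k : ℤ) τ := fun k => by
      congr 1; push_cast; ring
    simp only [e] at h
    rw [h]
    push_cast
    rw [hfneg, zero_sub]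
  rw [htel, Finset.sum_fn] at hsum
  simpa only [hfdef, hddef] using hsum

/-- **Geometric decay of the top flux on `[0,t]`** (`t < T`) along a `ν̂`-viscous flow that is (4.5)-regular on every
`[0,T']`, `T' < T`: there are `C_f ≥ 0` and `0 ≤ q < 1` (`q = Λ(1+ε₀)^{−10}`) with `|2Λ^K⟪x_{K+1}, A x_K⟫| ≤ C_f q^K` for
every `K` and every time in `[0,t]`. [cite: Tao2016AveragedNS, §4 (4.3), Lemma 4.1 (4.5), (4.9)] -/
theorem viscousTopFlux_le_geometric {ε₀ T : ℝ} (hε : 0 < ε₀)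
    {α : Fin m → Fin m → Fin m → ℤ × ℤ × ℤ → ℝ} (hc : IsCancellingCoeff α) {X : Fin m → ℤ → ℝ → ℝ}
    (hreg : ∀ T' : ℝ, T' < T → ∃ M : ℝ, ∀ t ∈ Icc 0 T', ∀ (i : Fin m) (k : ℤ),
      (1 + (1 + ε₀) ^ ((10 : ℝ) * k)) * |X i k t| ≤ M)
    {t : ℝ} (ht : t ∈ Ico 0 T) :
    ∃ Cf q : ℝ, 0 ≤ Cf ∧ 0 ≤ q ∧ q < 1 ∧ ∀ K : ℕ, ∀ τ ∈ Icc 0 t,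
      |2 * bigLam ε₀ ^ (K : ℤ) * ⟪shellVec X ((K : ℤ) + 1) τ, tableA α (shellVec X (K : ℤ) τ)⟫| ≤ Cf * q ^ K := by
  have hl0 : (0 : ℝ) < 1 + ε₀ := by linarith
  have hl1 : (1 : ℝ) < 1 + ε₀ := by linarith
  have hL : 0 < bigLam ε₀ := bigLam_pos (by linarith)
  have hS := table_sTable α hc
  obtain ⟨M₀, hM₀⟩ := hreg t ht.2
  set M : ℝ := max M₀ 0 with hMdef
  have hM : ∀ τ ∈ Icc (0 : ℝ) t, ∀ (i : Fin m) (k : ℤ), (1 + (1 + ε₀) ^ ((10 : ℝ) * k)) * |X i k τ| ≤ M :=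
    fun τ hτ i k => (hM₀ τ hτ i k).trans (le_max_left _ _)
  have hM0 : 0 ≤ M := le_max_right _ _
  have hW1 : ∀ k : ℤ, (1 : ℝ) ≤ 1 + (1 + ε₀) ^ ((10 : ℝ) * k) := fun k => by
    linarith [Real.rpow_nonneg hl0.le ((10 : ℝ) * k)]
  have hcomp : ∀ τ ∈ Icc (0 : ℝ) t, ∀ (i : Fin m) (k : ℤ), |X i k τ| ≤ M / (1 + (1 + ε₀) ^ ((10 : ℝ) * k)) :=
    fun τ hτ i k => by
      rw [le_div_iff₀ (lt_of_lt_of_le one_pos (hW1 k)), mul_comm]; exact hM τ hτ i k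
  have hxle : ∀ τ ∈ Icc (0 : ℝ) t, ∀ k : ℤ,
      ‖shellVec X k τ‖ ≤ Real.sqrt m * (M / (1 + (1 + ε₀) ^ ((10 : ℝ) * k))) :=
    fun τ hτ k => norm_shellVec_le_sqrt_mul (div_nonneg hM0 (lt_of_lt_of_le one_pos (hW1 k)).le)
      (fun i => hcomp τ hτ i k)
  have hxle' : ∀ τ ∈ Icc (0 : ℝ) t, ∀ k : ℤ, ‖shellVec X k τ‖ ≤ Real.sqrt m * M := fun τ hτ k =>
    (hxle τ hτ k).trans (mul_le_mul_of_nonneg_left (div_le_self hM0 (hW1 k)) (Real.sqrt_nonneg _))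
  set q : ℝ := bigLam ε₀ / (1 + ε₀) ^ (10 : ℝ) with hqdef
  have hP10 : 0 < (1 + ε₀) ^ (10 : ℝ) := Real.rpow_pos_of_pos hl0 _
  have hq0 : 0 ≤ q := div_nonneg hL.le hP10.le
  have hq1 : q < 1 := by
    rw [hqdef, div_lt_one hP10]
    unfold bigLam
    exact Real.rpow_lt_rpow_of_exponent_lt hl1 (by norm_num)
  set Cf : ℝ := 2 * fluxConst α * (Real.sqrt m * M) ^ 3 with hCfdef
  have hCf0 : 0 ≤ Cf := by
    have := fluxConst_nonneg α
    positivity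
  refine ⟨Cf, q, hCf0, hq0, hq1, fun K' τ hτ => ?_⟩
  have hA := hS.normA (shellVec X K' τ)
  have h1 : |⟪shellVec X ((K' : ℤ) + 1) τ, tableA α (shellVec X K' τ)⟫| ≤
      (Real.sqrt m * M) * (fluxConst α * (‖shellVec X (K' : ℤ) τ‖ * ‖shellVec X (K' : ℤ) τ‖)) := by
    refine (abs_real_inner_le_norm _ _).trans ?_
    rw [← sq]
    exact mul_le_mul (hxle' τ hτ _) hA (norm_nonneg _) (by positivity)
  have h2 : ‖shellVec X (K' : ℤ) τ‖ * ‖shellVec X (K' : ℤ) τ‖ ≤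
      (Real.sqrt m * M) * (Real.sqrt m * (M / (1 + (1 + ε₀) ^ ((10 : ℝ) * ((K' : ℤ) : ℝ))))) :=
    mul_le_mul (hxle' τ hτ _) (hxle τ hτ _) (norm_nonneg _) (by positivity)
  have hW : ((1 + ε₀) ^ (10 : ℝ)) ^ K' ≤ 1 + (1 + ε₀) ^ ((10 : ℝ) * ((K' : ℤ) : ℝ)) := by
    have : ((1 + ε₀) ^ (10 : ℝ)) ^ K' = (1 + ε₀) ^ ((10 : ℝ) * ((K' : ℤ) : ℝ)) := by
      rw [← Real.rpow_natCast, ← Real.rpow_mul hl0.le]; push_cast; ring_nf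
    linarith
  have hW0 : 0 < ((1 + ε₀) ^ (10 : ℝ)) ^ K' := pow_pos hP10 _
  have h3 : M / (1 + (1 + ε₀) ^ ((10 : ℝ) * ((K' : ℤ) : ℝ))) ≤ M / ((1 + ε₀) ^ (10 : ℝ)) ^ K' :=
    div_le_div_of_nonneg_left hM0 hW0 hW
  have hΛK : bigLam ε₀ ^ ((K' : ℤ)) = bigLam ε₀ ^ K' := zpow_natCast _ _
  rw [abs_mul, abs_mul, abs_two, hΛK, abs_of_pos (pow_pos hL _)]
  have hsm : 0 ≤ Real.sqrt m := Real.sqrt_nonneg _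
  calc 2 * bigLam ε₀ ^ K' * |⟪shellVec X ((K' : ℤ) + 1) τ, tableA α (shellVec X (K' : ℤ) τ)⟫|
      ≤ 2 * bigLam ε₀ ^ K' * ((Real.sqrt m * M) * (fluxConst α *
          ((Real.sqrt m * M) * (Real.sqrt m * (M / ((1 + ε₀) ^ (10 : ℝ)) ^ K'))))) := by
        refine mul_le_mul_of_nonneg_left (h1.trans ?_) (by positivity)
        refine mul_le_mul_of_nonneg_left (mul_le_mul_of_nonneg_left (h2.trans ?_)
          (fluxConst_nonneg α)) (by positivity)
        exact mul_le_mul_of_nonneg_left (mul_le_mul_of_nonneg_left h3 hsm) (by positivity)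
    _ = Cf * (bigLam ε₀ ^ K' / ((1 + ε₀) ^ (10 : ℝ)) ^ K') := by
        simp only [hCfdef]; field_simp
    _ = Cf * q ^ K' := by rw [hqdef, div_pow]

end BlowupRigidityOne

end Summit.NavierStokesRegularity.NavierStokesRegularity.Theorems

end
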